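import Literature.Probability.Percolation.AdjLaneCut
import HarnessLib

/-!
# The cut of the adjacent landing, with the rotation chosen from the tips alone

Topic `Literature/Probability/Percolation`; family `crit-perc` / near-critical percolation on `𝕋`.
A brick of the near-critical arm-separation theorem for four arms in the ADJACENT colour
arrangement (P. Nolin, EJP 13 (2008), Thm. 11, `j = 4`, `σ = BBWW` [arXiv 0711.4948: Thm. 10],
landing step, §4.4 p. 12 with Prop. 12 (i)); routing of the four corridors (`AdjLaneCut.lean`).

`Lanes.adj_exists_cut` chooses the rotation `r` from the tips AND the targets. But the target rows
must be chosen off the danger zones of the tips on their ACTUAL sides, which are known only once `r`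
is. This file removes the circularity: the rotation is chosen from the tips alone, so that the cut
`c = shd (2Mr) (τ 3 + 3s)` (just after the last closed tip) falls in the window
`[10M - R + 3s, 12M - R + 3s)` — the block of the side `5` of the rotated frame with its
margins (`exists_rot_mem_window`) — and then EVERY choice of middle target rows (rows in
`[-2M + R, -R]`) on the sides `0, 1, 3, 4` of the rotated frame reads `0, 1, 2, 3` from the cut, at
least `3s` after it (`targets_read_of_window`). With the tips (`adj_cut_tips` applied to
`(τ 3, τ 0, τ 1, τ 2)`): **`adj_exists_cut_univ`**.

Everything here is proved; no named facts are introduced.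

## References

* P. Nolin, Near-critical percolation in two dimensions, *Electron. J. Probab.* 13 (2008), §4.3
  Prop. 12 (i), §4.4 p. 12 (arXiv 0711.4948: Prop. 11; relocation of the landing areas) [Nolin2008].
-/

namespace Literature.Probability.Percolation

namespace Lanes

/-- **The rotation from the cut alone**: every `κ ∈ [0, 12M)` has a shift `shd (2Mr) κ`, `r < 6`, in
the window `[10M - R + 3s, 12M - R + 3s)` (`3s ≤ R ≤ 2M`, `1 ≤ M`). [folklore] -/
theorem exists_rot_mem_window {M s R : ℕ} (hM : 1 ≤ M) (hRs : 3 * s ≤ R) (hR : R ≤ 2 * M) {κ : ℤ} (hκ : 0 ≤ κ ∧ κ < 12 * M) :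
    ∃ r : ℕ, r < 6 ∧ 10 * (M : ℤ) - R + 3 * s ≤ shd M (2 * M * r) κ ∧ shd M (2 * M * r) κ < 12 * (M : ℤ) - R + 3 * s := by
  -- the offset of `κ` from the start `g = 10M - R + 3s` of the window, and its block
  have h2M : (0 : ℤ) < 2 * M := by omega
  obtain ⟨δ, hδ⟩ : ∃ δ : ℤ, δ = cyc (12 * M) (10 * (M : ℤ) - R + 3 * s) κ := ⟨_, rfl⟩
  have hδr : 0 ≤ δ ∧ δ < 12 * M := by rw [hδ]; exact cyc_range (by omega) (by omega) hκ.1 hκ.2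
  have hκrep : κ = 10 * (M : ℤ) - R + 3 * s + δ ∨ κ = 10 * (M : ℤ) - R + 3 * s + δ - 12 * M := by
    rw [hδ, cyc_eq_ite]; split_ifs <;> omega
  obtain ⟨q, hq⟩ : ∃ q : ℤ, q = δ / (2 * M) := ⟨_, rfl⟩
  have hq0 : 0 ≤ q := by rw [hq]; exact Int.ediv_nonneg hδr.1 h2M.le
  have hqδ : 2 * (M : ℤ) * q ≤ δ := by rw [hq]; exact Int.mul_ediv_self_le (by omega)
  have hδq : δ < 2 * (M : ℤ) * q + 2 * M := by rw [hq]; exact Int.lt_mul_ediv_self_add h2M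
  have hq6 : q < 6 := by
    by_contra h
    push Not at h
    have : 2 * (M : ℤ) * 6 ≤ 2 * (M : ℤ) * q := mul_le_mul_of_nonneg_left h (by omega)
    omega
  obtain ⟨r, hr⟩ : ∃ r : ℕ, (r : ℤ) = q := ⟨q.toNat, Int.toNat_of_nonneg hq0⟩
  have hr6 : r < 6 := by omega
  refine ⟨r, hr6, ?_⟩
  have hd : 2 * (M : ℤ) * r ≤ δ ∧ δ < 2 * (M : ℤ) * r + 2 * M := by rw [hr]; exact ⟨hqδ, hδq⟩
  unfold shd
  clear hq hq0 hqδ hδq hq6 hr hδ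
  interval_cases r <;> push_cast at hd ⊢ <;> split_ifs <;> omega

/-- **Targets read from a cut in the window.** If `c ∈ [10M - R + 3s, 12M - R + 3s)`
(`3s ≤ R`) and the target of the side `ts e` (`ts = 0, 1, 3, 4`) of the rotated frame has a middle row
`ρ e ∈ [-2M + R, -R]`, keys `v e = rotKey M (ts e) (ρ e)`, then from `c` the targets read `0, 1, 2, 3`
and all are at least `3s` after `c`. [folklore] -/
theorem targets_read_of_window {M s R : ℕ} (hs : 1 ≤ s) (hRs : 3 * s ≤ R) {c : ℤ}
    (hc : 10 * (M : ℤ) - R + 3 * s ≤ c ∧ c < 12 * (M : ℤ) - R + 3 * s) {ρ : Fin 4 → ℤ}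
    (hρ : ∀ e, -(2 * (M : ℤ)) + R ≤ ρ e ∧ ρ e ≤ -(R : ℤ)) :
    (cyc (12 * M) c (rotKey M 0 (ρ 0)) < cyc (12 * M) c (rotKey M 1 (ρ 1)) ∧
      cyc (12 * M) c (rotKey M 1 (ρ 1)) < cyc (12 * M) c (rotKey M 3 (ρ 2)) ∧
      cyc (12 * M) c (rotKey M 3 (ρ 2)) < cyc (12 * M) c (rotKey M 4 (ρ 3))) ∧
    (3 * (s : ℤ) ≤ cyc (12 * M) c (rotKey M 0 (ρ 0)) ∧ 3 * (s : ℤ) ≤ cyc (12 * M) c (rotKey M 1 (ρ 1)) ∧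
      3 * (s : ℤ) ≤ cyc (12 * M) c (rotKey M 3 (ρ 2)) ∧ 3 * (s : ℤ) ≤ cyc (12 * M) c (rotKey M 4 (ρ 3))) := by
  have h0 := hρ 0; have h1 := hρ 1; have h2 := hρ 2; have h3 := hρ 3
  unfold rotKey
  simp only [cyc_eq_ite, Nat.cast_zero, Nat.cast_one, Nat.cast_ofNat, mul_zero, mul_one, zero_add]
  refine ⟨⟨?_, ?_, ?_⟩, ?_, ?_, ?_, ?_⟩ <;> split_ifs <;> omega

/-- **The cut of the adjacent landing, the rotation chosen from the tips.** Tips `τ a ∈ [0, 12M)`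
(`a = 0, 1` open, `2, 3` closed) cyclically increasing from `τ 0`, the gap from the last closed tip
`τ 3` to the first open tip `τ 0` at least `6s` (`1 ≤ s`, `3s ≤ R ≤ 2M`). Then for some rotation
`r < 6` and the cut `c = shd (2Mr) (τ 3 + 3s mod 12M) ∈ [0, 12M)`: the shifted tips read `0, 1, 2, 3`
from `c`, each at least `3s` after it, the cut lies in the window `[10M - R + 3s, 12M - R + 3s)`, so
that any middle targets on the sides `0, 1, 3, 4` read `0, 1, 2, 3` from it (`targets_read_of_window`),
and the formula for `c` is recorded. [cite: Nolin2008, §4.3 Prop. 12 (i) and §4.4 p. 12 (arXiv 0711.4948: Prop. 11; relocation of the landing areas)] -/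
theorem adj_exists_cut_univ {M s R : ℕ} (hM : 1 ≤ M) (hs : 1 ≤ s) (hRs : 3 * s ≤ R) (hR : R ≤ 2 * M) {τ : Fin 4 → ℤ}
    (hτ : ∀ a, 0 ≤ τ a ∧ τ a < 12 * M)
    (hτcyc : cyc (12 * M) (τ 0) (τ 1) < cyc (12 * M) (τ 0) (τ 2) ∧ cyc (12 * M) (τ 0) (τ 2) < cyc (12 * M) (τ 0) (τ 3))
    (h01 : 0 < cyc (12 * M) (τ 0) (τ 1)) (hgap : 6 * (s : ℤ) ≤ cyc (12 * M) (τ 3) (τ 0)) :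
    ∃ r : ℕ, r < 6 ∧ ∃ c : ℤ, 0 ≤ c ∧ c < 12 * M ∧
      (cyc (12 * M) c (shd M (2 * M * r) (τ 0)) < cyc (12 * M) c (shd M (2 * M * r) (τ 1)) ∧
        cyc (12 * M) c (shd M (2 * M * r) (τ 1)) < cyc (12 * M) c (shd M (2 * M * r) (τ 2)) ∧
        cyc (12 * M) c (shd M (2 * M * r) (τ 2)) < cyc (12 * M) c (shd M (2 * M * r) (τ 3))) ∧
      (∀ a, 3 * (s : ℤ) ≤ cyc (12 * M) c (shd M (2 * M * r) (τ a))) ∧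
      (10 * (M : ℤ) - R + 3 * s ≤ c ∧ c < 12 * (M : ℤ) - R + 3 * s) ∧
      c = shd M (2 * M * r) (if τ 3 + 3 * s < 12 * M then τ 3 + 3 * s else τ 3 + 3 * s - 12 * M) := by
  have hτ0 := hτ 0; have hτ1 := hτ 1; have hτ2 := hτ 2; have hτ3 := hτ 3
  -- the tips in the order `3, 0, 1, 2` are cyclically increasing from `τ 3`
  set τ' : Fin 4 → ℤ := ![τ 3, τ 0, τ 1, τ 2] with hτ'
  have hτ'r : ∀ a, 0 ≤ τ' a ∧ τ' a < 12 * M := by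
    intro a; fin_cases a <;> simp [hτ'] <;> omega
  have hlin := cyc_lin hτ0 hτ1 hτ2 hτ3 hτcyc h01
  have hcyc' : cyc (12 * M) (τ' 0) (τ' 1) < cyc (12 * M) (τ' 0) (τ' 2) ∧ cyc (12 * M) (τ' 0) (τ' 2) < cyc (12 * M) (τ' 0) (τ' 3) := by
    simp only [hτ', Matrix.cons_val_zero, Matrix.cons_val_one, Matrix.cons_val]
    simp only [cyc_eq_ite]
    rcases hlin with h | h | h | h <;> split_ifs <;> omega
  have h01' : 0 < cyc (12 * M) (τ' 0) (τ' 1) := by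
    simp only [hτ', Matrix.cons_val_zero, Matrix.cons_val_one]
    have hs6 : (6 : ℤ) ≤ 6 * s := by omega
    exact lt_of_lt_of_le (by norm_num) (hs6.trans hgap)
  have hg : 6 * (s : ℤ) ≤ cyc (12 * M) (τ' 0) (τ' 1) := by
    simp only [hτ', Matrix.cons_val_zero, Matrix.cons_val_one]; exact hgap
  obtain ⟨c₀, hc₀⟩ : ∃ c₀ : ℤ, c₀ = if τ' 0 + 3 * s < 12 * M then τ' 0 + 3 * s else τ' 0 + 3 * s - 12 * M := ⟨_, rfl⟩
  have hc₀r : 0 ≤ c₀ ∧ c₀ < 12 * M := by rw [hc₀]; have := hτ'r 0; split_ifs <;> omega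
  obtain ⟨hord, f0, f1, f2, f3⟩ := adj_cut_tips hs hτ'r hcyc' h01' hg (by omega) hc₀
  -- the rotation from the cut alone
  obtain ⟨r, hr6, hw1, hw2⟩ := exists_rot_mem_window (s := s) hM hRs hR hc₀r
  have hd0 : 0 ≤ (2 * M * r : ℤ) ∧ (2 * M * r : ℤ) < 12 * M := by interval_cases r <;> push_cast <;> omega
  refine ⟨r, hr6, shd M (2 * M * r) c₀, (shd_range hd0 hc₀r).1, (shd_range hd0 hc₀r).2, ?_, fun a => ?_, ⟨hw1, hw2⟩, by
    rw [hc₀]; simp [hτ']⟩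
  · rw [cyc_shd hd0 (hτ 0) hc₀r, cyc_shd hd0 (hτ 1) hc₀r, cyc_shd hd0 (hτ 2) hc₀r, cyc_shd hd0 (hτ 3) hc₀r]
    simp only [hτ', Matrix.cons_val_zero, Matrix.cons_val_one, Matrix.cons_val] at hord
    exact hord
  · rw [cyc_shd hd0 (hτ a) hc₀r]
    fin_cases a
    · simpa [hτ'] using f1
    · simpa [hτ'] using f2
    · simpa [hτ'] using f3
    · simpa [hτ'] using f0

end Lanes

end Literature.Probability.Percolation
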